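import Summits.BirchSwinnertonDyer.BirchSwinnertonDyer.Theorems.ByReductionTypeAtTwoAdditivePotMultConjATwoOddPowerCertificate
import Summits.BirchSwinnertonDyer.BirchSwinnertonDyer.Theorems.ByReductionTypeAtTwoFineSelmerConjAAtTwoAdditivePotGoodAscentStampsA
import HarnessLib

/-!
# C4″ `AdditivePotMultOverKAtTwo` (item stmt-BirchSwinnertonDyer-22618), the (I1M′) input of the upper half on the `0 < Δ` rows:
# LAYER-TWO NARROW CERTIFICATE `d = 8220`, part CLASS — the totally real cubic `2`-torsion field of discriminant `8220` (`X³ + (-21)X² + (0)X + (2)`): irreducibility and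
# ODD CLASS NUMBER by a norm certificate below the Minkowski bound (KERNEL; GEN 11's generator; rows 131520cg1)

Cell `bsd-2adic`, rung K4, seat `bsd-2adic-k4-w3` GEN 14 (explicit unit of director-bsd g16 (309)(7); `--supports stmt-BirchSwinnertonDyer-22618`).
HONEST FRAMING (D-0036/D-0054/D-0152): THEOREMS ONLY (no definition, no named fact, no `sorry`, no instance). The series `…NarrowTwo8220{Class, Field,
Dyadic, Residues, TotPos, Integers, Parity, SignsA/B/C, Units, Rows}` carries k4-w1 GEN 11's zero-hypothesis LAYER-TWO narrow certificate (row `261648q1`,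
`…NarrowRankCertificate316*`: `h(A₁)`, `h(A₂)` odd by genus theory with one dyadic non-norm unit, ONE totally positive non-square unit of `A₁ = ℚ(θ,√2)`,
ELEVEN sign-independent units of `A₂ = ℚ(θ,√(2+√2))`, k4-w2's Edgar–Mollin–Peterson door `a = 1, b = 11`, cruxlead-19573-w2's rung `m = 1`) to the
totally real cubic `2`-torsion field of discriminant `8220` (`X³ + (-21)X² + (0)X + (2)`) of the C4″ census rows 131520cg1 (eng-2 CERT-ADD-POTMULT-POS81-AB-E2:
`n₀ = 0`, `rank₂ Cl⁺ = [0,1,1]`, unit signature ranks `[3,5,11]`, `h = 1` at layers `0,1,2` — letter NARROW-EQUAL12, instrument grade `grh`; here KERNEL).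
All certificates were found by the seat's exact-arithmetic tools (`k4w3/gen13/tools`: GEN 12 `narrowcert/unitlib` + layer-two arithmetic `nf12/cert2`) and are CHECKED
HERE by the kernel. Statement (A) is NOT BSD: BSD₂ for these curves is not proved; C4″ / (I1M′) stay research-open; nothing booked; no row of 22618 changes tier
(pen RC-490 (4)); BSD is not proved by any of this.

References: [CoatesSujatha2005] Conj. A, Thm. 3.4; [Fukuda1994] Thm. 1 (2); [EdgarMollinPeterson1986] Thm. 2.1; [FrohlichTaylor1990] Ch. V §1 (1.8)–(1.13);
[Lang1990] Ch. 13 §4 Lemma 4.1; [Washington1997] §13.1, Prop. 13.2; [Cohen1993] §4.1.3, §6.3; [Marcus1977] Ch. 5 Thm. 22, 35–37; [Omeara1963] §63.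
-/

set_option autoImplicit false
-- sibling precedent (`…NarrowStampsAClass.lean`): the directory name repeats the summit name
set_option linter.dupNamespace false

noncomputable section

open scoped Classical IntermediateField NumberField

namespace Summit.BirchSwinnertonDyer.BirchSwinnertonDyer.Theorems.AddKatoTwo

open WeierstrassCurve Field Polynomial IsDedekindDomain NumberField Matrix Literature.NumberTheory.EllipticCurves
  Literature.NumberTheory.GaloisRepresentations
  Literature.NumberTheory.IwasawaTheory
  Summit.BirchSwinnertonDyer.BirchSwinnertonDyer.Theorems.SteinbergFibreAtTwo
  Summit.BirchSwinnertonDyer.BirchSwinnertonDyer.Theorems.AlignedTransportAtTwoTorsionPointField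

/-! ## The cubic field of discriminant `8220` — odd-index generator `X³ + (-21)X² + (0)X + (2)` (`[𝓞 : ℤ[θ]] = 3`; eng-2's polredabs cubic `X³ + (-1)X² + (-20)X + (12)` has
index `2`; `θ = (1) + (-5/2)·θ₀ + (1/2)·θ₀²`); C4″ rows 131520cg1 -/

/-- `X³ + (-21)X² + (0)X + (2)` is irreducible over `ℚ` (no root mod `7`). -/
theorem irreducible_cubic_d8220p : Irreducible (Cubic.toPoly ⟨1, ((-21 : ℤ) : ℚ), ((0 : ℤ) : ℚ), ((2 : ℤ) : ℚ)⟩) :=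
  haveI : Fact (Nat.Prime 7) := ⟨by norm_num⟩
  irreducible_cubic_of_no_root_zmod 7 (by decide)

/-- `X³ + (-1)X² + (-20)X + (12)` (a second generator of the same field) is irreducible over `ℚ` (no root mod `7`). -/
theorem irreducible_cubic_d8220p_aux : Irreducible (Cubic.toPoly ⟨1, ((-1 : ℤ) : ℚ), ((-20 : ℤ) : ℚ), ((12 : ℤ) : ℚ)⟩) :=
  haveI : Fact (Nat.Prime 7) := ⟨by norm_num⟩
  irreducible_cubic_of_no_root_zmod 7 (by decide)

section Certd8220p

variable (K : Type) [Field K] [NumberField K]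

/-- **`h` is ODD for every cubic number field whose integers contain a root `θ` of `X³ + (-21)X² + (0)X + (2)`** (`|disc| = 73980 = 3²·8220`,
`|d_K| ≤ 8220` by the index-`3` element `θ₀`, `M_K < 26`): a norm certificate — for every prime `ℓ < 26` and every root `a` of the cubic mod `ℓ` a generator
`(x + yθ + zθ²)/m ∈ 𝓞 K` of the ideal `I ∋ ℓ, θ − a` of norm `ℓ`, or of its CUBE with Bézout data (7 witnesses; 0 cube witnesses; 0 with `m > 1` outside `ℤ[θ]`; the prime(s) dividing the index `3` through the
second generator `θ₀` of `𝓞 K` (`exists_intElem_of_scaled_cubic`), 2 witnesses). Found by the seat's relation sieve (Hermite normal form over the `S`-unit lattice) and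
CHECKED HERE by the kernel (`pow_three_eq_span_of_cert`). eng-2's PARI value (bnfcertify): `h = 1`. KERNEL. [cite: Marcus1977, Ch. 5 Thm. 35–37 and Cor. 2] [cite: Cohen1993, §6.3] -/
theorem odd_classNumber_of_root_d8220p (h3 : Module.finrank ℚ K = 3) (b : 𝓞 K)
    (hb : b ^ 3 + (-21 : ℤ) * b ^ 2 + (0 : ℤ) * b + (2 : ℤ) = 0) : Odd (NumberField.classNumber K) := by
  have hirr := irreducible_cubic_d8220p
  -- second generator `b2 = ((8) + (20)θ + (-1)θ²)/3`, a root of `X³ + (-1)X² + (-20)X + (12)` (index prime to `3`)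
  obtain ⟨b2, hb2m, hb2⟩ := exists_intElem_of_scaled_cubic K b (8) (20) (-1) (m := 3) (by norm_num) (-1) (-20) (12)
    (by push_cast; linear_combination (((-398 : ℤ) : 𝓞 K) + ((-360 : ℤ) : 𝓞 K) * b + ((39 : ℤ) : 𝓞 K) * b ^ 2 + ((-1 : ℤ) : 𝓞 K) * b ^ 3 + ((0 : ℤ) : 𝓞 K) * b ^ 4) * hb)
  have hd : |NumberField.discr K| ≤ (8220 : ℕ) :=
    abs_discr_le_of_sq_mul_le K (k := 3) (by norm_num)
      (sq_mul_abs_discr_le_abs_cubic_discr K h3 b hirr hb (by norm_num) (8) (20) (-1) ⟨b2, hb2m⟩ (by norm_num))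
      (by simp only [Cubic.discr]; norm_num)
  have hirr2 := irreducible_cubic_d8220p_aux
  refine odd_classNumber_of_cubeCertificate K h3 (B := 26)
    (minkowskiBound_lt_of_sqrt_le K h3 hd (s := 90.67)
      ((Real.sqrt_le_sqrt (by norm_num : ((8220 : ℕ) : ℝ) ≤ (90.67 : ℝ) ^ 2)).trans (Real.sqrt_sq (by norm_num)).le)
      (by norm_num)) ?_
  intro ℓ hℓB hℓ J hJ
  interval_cases ℓ <;> norm_num at hℓ
  · -- `ℓ = 2`: roots [0, 1]
    refine pow_three_eq_span_of_cert K h3 b hirr hb (by norm_num) (fun a ha hdvd => ?_) hJ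
    interval_cases a <;> norm_num at hdvd
    · exact Or.inl ⟨(0), (-1), (0), 1, by norm_num, by norm_num, ⟨_, by rw [Nat.cast_one, one_mul]⟩, by norm_num⟩
    · exact Or.inl ⟨(21), (-1), (0), 1, by norm_num, by norm_num, ⟨_, by rw [Nat.cast_one, one_mul]⟩, by norm_num⟩
  · -- `ℓ = 3` divides the index of `ℤ[θ]`: second generator `b2`, roots [0, 2]
    refine pow_three_eq_span_of_cert K h3 b2 hirr2 hb2 (by norm_num) (fun a ha hdvd => ?_) hJ
    interval_cases a <;> norm_num at hdvd
    · exact Or.inl ⟨(-3), (-5), (-1), 1, by norm_num, by norm_num, ⟨_, by rw [Nat.cast_one, one_mul]⟩, by norm_num⟩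
    · exact Or.inl ⟨(-43), (-10), (0), 1, by norm_num, by norm_num, ⟨_, by rw [Nat.cast_one, one_mul]⟩, by norm_num⟩
  · -- `ℓ = 5`: roots [3, 4]
    refine pow_three_eq_span_of_cert K h3 b hirr hb (by norm_num) (fun a ha hdvd => ?_) hJ
    interval_cases a <;> norm_num at hdvd
    · exact Or.inl ⟨(3), (0), (-32), 1, by norm_num, by norm_num, ⟨_, by rw [Nat.cast_one, one_mul]⟩, by norm_num⟩
    · exact Or.inl ⟨(-3), (-15), (-17), 1, by norm_num, by norm_num, ⟨_, by rw [Nat.cast_one, one_mul]⟩, by norm_num⟩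
  · -- `ℓ = 7`: roots []
    refine pow_three_eq_span_of_cert K h3 b hirr hb (by norm_num) (fun a ha hdvd => ?_) hJ
    interval_cases a <;> norm_num at hdvd
  · -- `ℓ = 11`: roots []
    refine pow_three_eq_span_of_cert K h3 b hirr hb (by norm_num) (fun a ha hdvd => ?_) hJ
    interval_cases a <;> norm_num at hdvd
  · -- `ℓ = 13`: roots []
    refine pow_three_eq_span_of_cert K h3 b hirr hb (by norm_num) (fun a ha hdvd => ?_) hJ
    interval_cases a <;> norm_num at hdvd
  · -- `ℓ = 17`: roots []
    refine pow_three_eq_span_of_cert K h3 b hirr hb (by norm_num) (fun a ha hdvd => ?_) hJ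
    interval_cases a <;> norm_num at hdvd
  · -- `ℓ = 19`: roots [7]
    refine pow_three_eq_span_of_cert K h3 b hirr hb (by norm_num) (fun a ha hdvd => ?_) hJ
    interval_cases a <;> norm_num at hdvd
    · exact Or.inl ⟨(1), (-2), (-4), 1, by norm_num, by norm_num, ⟨_, by rw [Nat.cast_one, one_mul]⟩, by norm_num⟩
  · -- `ℓ = 23`: roots []
    refine pow_three_eq_span_of_cert K h3 b hirr hb (by norm_num) (fun a ha hdvd => ?_) hJ
    interval_cases a <;> norm_num at hdvd

end Certd8220p

end Summit.BirchSwinnertonDyer.BirchSwinnertonDyer.Theorems.AddKatoTwo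

end
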